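import Summits.QuantumFields.YangMills.Theorems.FlatTubeReductionDecimationPairs
import Summits.QuantumFields.YangMills.Theorems.FlatTubeReductionDecimationReadingBaseAll
import HarnessLib

/-!
# Route `FlatTubeReduction`, crux `PinnedUnitStepEx` (stmt-QuantumFields-27561), stub `stub_smearVarPosGS1` — E2: W-inj(m = 1)

Seat ym-line-fcl-p3 g9 (2026-08-28).  Blueprint v2 §E2, the assembly: **the translation-smeared unit decimation pull-back is injective on
non-constant gauge- and translation-invariant bounded observables** (general compact group form `ae_eq_const_of_smear_ae_const`; the `SU(2)`
named target `WInjUnit` is discharged from it in the stub file, outside this route-independent module).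

Proof (Hoeffding/Efron–Stein parts `g^{=R}` w.r.t. product Haar): if `S_g := Σ_v g ∘ thin ∘ τ_v` is a.e. constant, every part
`g^{=R}`, `R ≠ ∅`, vanishes a.e.  Otherwise pick a surviving `R` of maximal potential `maxPot` and put it in normal form (`R₁`); by the
fine identity `smearParts_ae_eq_zero` the sum of the pulled-back parts over the pairs `(v, R)` decoding to the fine support of `(0, R₁)` vanishes
a.e.; every surviving decoded `R` has `mrun_j R ≥ mrun_j R₁` in each direction (`mrun_decoded_ge`), hence equality by maximality, hence the decoder is
trivial or Polyakov in each direction and its term equals `g^{=R₁} ∘ thin` pointwise (`decoded_term_eq`: translate lemma + one-site gauge steps);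
so `N · g^{=R₁} ∘ thin = 0` a.e. with `N ≥ 1`, i.e. `g^{=R₁} = 0` a.e., a contradiction.  Then `g = Σ_R g^{=R} = g^{=∅} = ∫ g` a.e.
R2b1 RECORD rung; no summit/crux/stub by name here (the stub file is separate).
-/

set_option autoImplicit false

noncomputable section

namespace Summit.QuantumFields.YangMills.Theorems.FlatTubeReduction.Decimation

open MeasureTheory Finset Function
open Literature.MathematicalPhysics.QuantumFieldTheory (Site Edge GaugeConfig haarProbability gaugeTransform)
open Literature.MathematicalPhysics.QuantumFieldTheory.TorusTranslation
open Summit.QuantumFields.YangMills.Theorems.FemtoCutoffLadder.Thinning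
open Summit.QuantumFields.YangMills.Theorems.FemtoTransferGap (configMeasure)
open Literature.Probability.Independence.Hoeffding

variable {L' : ℕ} [NeZero L']

section General

variable {G : Type*} [Group G] [MeasurableSpace G] [TopologicalSpace G] [IsTopologicalGroup G] [CompactSpace G] [BorelSpace G]
  [T2Space G] [SecondCountableTopology G]

/-- All slices are contractible when the maximal run is the full period. [folklore] -/
theorem isContr_all_of_mrun_eq {R : Finset (Edge 3 L')} {j : Fin 3} (h : mrun j R = L') (a : ZMod L') : IsContr j a R := by
  have hw := hasWin_mrun j R
  rw [h] at hw
  exact isContr_of_hasWin_top hw a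

/-- A single contractible slice gives `1 ≤ mrun`. [folklore] -/
theorem one_le_mrun_of_isContr {R : Finset (Edge 3 L')} {j : Fin 3} {a : ZMod L'} (h : IsContr j a R) : 1 ≤ mrun j R :=
  le_mrun_of_hasWin (NeZero.one_le) ⟨a, fun i hi => by
    have hi0 : i = 0 := by omega
    subst hi0; simpa using h⟩

/-- **Monotonicity of the runs under decoding from a normal form**: if `(v, R)` decodes to the fine support of the normal-form `R₁` then
`mrun_j R₁ ≤ mrun_j R` in every direction. [folklore] -/
theorem mrun_decoded_ge {R₁ R : Finset (Edge 3 L')} {v : Site 3 (L' + 1)} (hF : fineSupp (L' + 1) v R = fineSupp (L' + 1) 0 R₁) (j : Fin 3)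
    (hnf : 0 < mrun j R₁ → mrun j R₁ < L' → (∀ i : ℕ, i < mrun j R₁ → IsContr j (1 + (i : ZMod L')) R₁) ∧ ¬ IsContr j 0 R₁) :
    mrun j R₁ ≤ mrun j R := by
  by_cases h0 : mrun j R₁ = 0
  · rw [h0]; exact Nat.zero_le _
  by_cases hL : mrun j R₁ < L'
  · exact le_mrun_of_hasWin hL.le (hasWin_decoded_of_normalForm hF (Nat.pos_of_ne_zero h0) hL (hnf (Nat.pos_of_ne_zero h0) hL).1)
  · have hEq : mrun j R₁ = L' := le_antisymm (mrun_le j R₁) (not_lt.1 hL)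
    have hall : ∀ a : ZMod L', IsContr j a R := isContr_decoded_of_all hF (isContr_all_of_mrun_eq hEq)
    rw [hEq]
    exact le_mrun_of_hasWin le_rfl ⟨0, fun i _ => hall _⟩

omit [T2Space G] [SecondCountableTopology G] in
/-- **The term of a surviving decoded pair.**  If `(v, R)` decodes to the fine support of the normal-form `R₁` with equal runs in all
directions, then `R = R₁ − m̄` is a translate along trivial decoder components (Polyakov directions contribute `m̄_j = 0`), and
`g^{=R} ∘ thin ∘ τ_v = g^{=R₁} ∘ thin` pointwise. [folklore] -/
theorem decoded_term_eq {g : GaugeConfig 3 L' G → ℝ} (hg : Measurable g) {C : ℝ} (hC : ∀ U, |g U| ≤ C)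
    (hGI : ∀ (k : Site 3 L' → G) (W : GaugeConfig 3 L' G), g (gaugeTransform k W) = g W)
    (hTI : ∀ (w : Site 3 L') (U : GaugeConfig 3 L' G), g (torusConfigShift w U) = g U)
    {R₁ R : Finset (Edge 3 L')} {v : Site 3 (L' + 1)} (hF : fineSupp (L' + 1) v R = fineSupp (L' + 1) 0 R₁)
    (hnf : ∀ j : Fin 3, 0 < mrun j R₁ → mrun j R₁ < L' →
      (∀ i : ℕ, i < mrun j R₁ → IsContr j (1 + (i : ZMod L')) R₁) ∧ ¬ IsContr j 0 R₁)
    (heq : ∀ j : Fin 3, mrun j R = mrun j R₁) (U : GaugeConfig 3 (L' + 1) G) :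
    esPart (haarProbability G) R g (thin L' (torusConfigShift v U)) = esPart (haarProbability G) R₁ g (thin L' U) := by
  -- the run in direction `j` (vacuous when `mrun_j R₁ = 0`)
  have hrun : ∀ j : Fin 3, mrun j R₁ < L' → ∀ i : ℕ, i < mrun j R₁ → IsContr j (1 + (i : ZMod L')) R₁ := by
    intro j hL i hi
    by_cases h0 : mrun j R₁ = 0
    · omega
    · exact (hnf j (Nat.pos_of_ne_zero h0) hL).1 i hi
  -- the decoder data, direction by direction
  have hdata : ∀ j : Fin 3, ∃ m : ℕ, (v j = -((m : ℕ) : ZMod (L' + 1)) ∧ m ≤ mrun j R₁ ∧ mrun j R₁ < L') ∨ (m = 0 ∧ mrun j R₁ = L') := by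
    intro j
    by_cases hL : mrun j R₁ < L'
    · by_cases h0 : mrun j R₁ = 0
      · refine ⟨0, Or.inl ⟨?_, le_rfl.trans (Nat.zero_le _), hL⟩⟩
        have hnone : ∀ a : ZMod L', ¬ IsContr j a R₁ := fun a ha => by
          have := one_le_mrun_of_isContr ha; omega
        rw [decoder_eq_zero_of_none hF hnone]; simp
      · have hno : ¬ HasWin j R (mrun j R₁ + 1) := by
          rw [← heq j]; exact not_hasWin_succ_mrun ((heq j).symm ▸ hL)
        obtain ⟨m, hm, hv⟩ := decoder_mem_run hF hL (hrun j hL) hno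
        exact ⟨m, Or.inl ⟨hv, hm, hL⟩⟩
    · exact ⟨0, Or.inr ⟨rfl, le_antisymm (mrun_le j R₁) (not_lt.1 hL)⟩⟩
  choose mf hmf using hdata
  let mbar : Site 3 L' := fun j => ((mf j : ℕ) : ZMod L')
  -- (1) the translate lemma: `R = R₁ − m̄`
  have hstep : ∀ (x : Site 3 L') (k : Fin 3), ∃ n : ℕ,
      (thinSite (L' + 1) (x + mbar)) k = (thinSite (L' + 1) x - v) k + (n : ZMod (L' + 1)) ∧
        ∀ t : ℕ, t ≤ n → 0 < n → IsContr k ((thinSite (L' + 1) x - v) k + (t : ZMod (L' + 1))) (fineSupp (L' + 1) 0 R₁) := by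
    intro x k
    have hxk : (thinSite (L' + 1) (x + mbar)) k = thinCoord (L' + 1) L' (x k + ((mf k : ℕ) : ZMod L')) := rfl
    have hvk : (thinSite (L' + 1) x - v) k = thinCoord (L' + 1) L' (x k) - v k := rfl
    rw [hxk, hvk]
    rcases hmf k with ⟨hv, hm, hL⟩ | ⟨hm0, hEq⟩
    · rw [hv, sub_neg_eq_add]
      exact decoder_step_data hL hm (hrun k hL) (x k)
    · refine ⟨(v k).val, ?_, fun t _ _ => ?_⟩
      · rw [hm0, Nat.cast_zero, add_zero, ZMod.natCast_zmod_val, sub_add_cancel]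
      · have hall : ∀ a : ZMod L', IsContr k a R₁ := isContr_all_of_mrun_eq hEq
        rw [isContr_fineSupp_zero_iff]
        rcases fine_coord_cases (thinCoord (L' + 1) L' (x k) - v k + (t : ZMod (L' + 1))) with hc | ⟨a, ha⟩
        · exact Or.inl hc
        · exact Or.inr ⟨a, ha, hall a⟩
  have hR : R = shiftLinks (-mbar) R₁ := decoded_eq_shiftLinks hF mbar hstep
  -- (2) admissibility for the base reduction
  have hadm : ∀ j : Fin 3, (∃ m : ℕ, mbar j = (m : ZMod L') ∧ v j = -((m : ℕ) : ZMod (L' + 1)) ∧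
        ∀ t : ℕ, t < m → ∀ e ∈ R₁, e.1 j = 1 + (t : ZMod L') → e.2 = j) ∨
      (mbar j = 0 ∧ shiftLinks (Pi.single j (1 : ZMod L') : Site 3 L') R₁ = R₁ ∧ ∀ e ∈ R₁, e.2 = j) := by
    intro j
    rcases hmf j with ⟨hv, hm, hL⟩ | ⟨hm0, hEq⟩
    · exact Or.inl ⟨mf j, rfl, hv, fun t ht e he h1 => (hrun j hL t (lt_of_lt_of_le ht hm)).1 e he h1⟩
    · have hP := polyakov_structure (isContr_all_of_mrun_eq hEq)
      refine Or.inr ⟨?_, hP.2, hP.1⟩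
      change ((mf j : ℕ) : ZMod L') = 0
      rw [hm0, Nat.cast_zero]
  rw [hR, esPart_shiftLinks_reading hg hC hTI R₁ mbar v U]
  exact esPart_reading_eq_base' hg hC hGI hTI R₁ mbar v hadm U

/-- **W-inj(m = 1), parts form**: if the smeared unit-decimation pull-back of a bounded measurable gauge- and translation-invariant `g` is
a.e. constant, then every Hoeffding part `g^{=R}`, `R ≠ ∅`, vanishes a.e. [folklore] -/
theorem esPart_ae_eq_zero_of_smear_ae_const {g : GaugeConfig 3 L' G → ℝ} (hg : Measurable g) {C : ℝ} (hC : ∀ U, |g U| ≤ C)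
    (hGI : ∀ (k : Site 3 L' → G) (W : GaugeConfig 3 L' G), g (gaugeTransform k W) = g W)
    (hTI : ∀ (w : Site 3 L') (U : GaugeConfig 3 L' G), g (torusConfigShift w U) = g U) {c : ℝ}
    (hS : (fun U : GaugeConfig 3 (L' + 1) G => ∑ v : Site 3 (L' + 1), g (thin L' (torusConfigShift v U))) =ᵐ[configMeasure G (L' + 1)]
      fun _ => c)
    (R : Finset (Edge 3 L')) (hRne : R.Nonempty) : esPart (haarProbability G) R g =ᵐ[configMeasure G L'] 0 := by
  classical
  set η := haarProbability G with hη
  by_contra hne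
  -- a surviving part of maximal potential, in normal form
  let S : Finset (Finset (Edge 3 L')) := univ.filter fun T => T.Nonempty ∧ ¬ (esPart η T g =ᵐ[configMeasure G L'] 0)
  have hRS : R ∈ S := mem_filter.2 ⟨mem_univ _, hRne, hne⟩
  obtain ⟨Rm, hRm, hmax⟩ := exists_max_image S maxPot ⟨R, hRS⟩
  obtain ⟨hRmne, hRmS⟩ := (mem_filter.1 hRm).2
  obtain ⟨w, hw⟩ := exists_normalForm Rm
  set R₁ : Finset (Edge 3 L') := shiftLinks w Rm with hR₁
  have hR₁ne : R₁.Nonempty := hRmne.image _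
  have hR₁S : ¬ (esPart η R₁ g =ᵐ[configMeasure G L'] 0) := fun h =>
    hRmS ((esPart_image_shift_ae_eq_zero_iff hg hC hTI Rm w).1 h)
  have hmr : ∀ j : Fin 3, mrun j R₁ = mrun j Rm := fun j => mrun_shiftLinks j w Rm
  have hnf : ∀ j : Fin 3, 0 < mrun j R₁ → mrun j R₁ < L' →
      (∀ i : ℕ, i < mrun j R₁ → IsContr j (1 + (i : ZMod L')) R₁) ∧ ¬ IsContr j 0 R₁ := by
    intro j h0 hL
    rw [hmr j] at h0 hL ⊢
    exact hw j h0 hL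
  have hmax' : ∀ T : Finset (Edge 3 L'), T.Nonempty → ¬ (esPart η T g =ᵐ[configMeasure G L'] 0) → maxPot T ≤ maxPot R₁ := by
    intro T h1 h2
    rw [hR₁, maxPot_shiftLinks]
    exact hmax T (mem_filter.2 ⟨mem_univ _, h1, h2⟩)
  -- the fine identity on the fine support of `(0, R₁)`
  set F : Finset (Edge 3 (L' + 1)) := fineSupp (L' + 1) (0 : Site 3 (L' + 1)) R₁ with hFdef
  have hF : F.Nonempty := by
    rw [Finset.nonempty_iff_ne_empty]
    intro h
    exact hR₁ne.ne_empty ((fineSupp_eq_empty_iff (0 : Site 3 (L' + 1)) R₁).1 h)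
  have hstar := smearParts_ae_eq_zero (L := L' + 1) (L' := L') (G := G) (Nat.le_succ L') hg hC hS F hF
  -- every surviving decoded pair contributes the base term
  have hterm : ∀ (v : Site 3 (L' + 1)) (T : Finset (Edge 3 L')), fineSupp (L' + 1) v T = F →
      ¬ (esPart η T g =ᵐ[configMeasure G L'] 0) → ∀ U, esPart η T g (thin L' (torusConfigShift v U)) = esPart η R₁ g (thin L' U) := by
    intro v T hFT hT U
    have hTne : T.Nonempty := by
      rw [Finset.nonempty_iff_ne_empty]
      intro h
      rw [h, (fineSupp_eq_empty_iff v (∅ : Finset (Edge 3 L'))).2 rfl] at hFT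
      exact hF.ne_empty hFT.symm
    have hle : maxPot T ≤ maxPot R₁ := hmax' T hTne hT
    have hge : ∀ j : Fin 3, mrun j R₁ ≤ mrun j T := fun j => mrun_decoded_ge hFT j (hnf j)
    have hsumeq : ∑ j : Fin 3, mrun j R₁ = ∑ j : Fin 3, mrun j T :=
      le_antisymm (Finset.sum_le_sum fun j _ => hge j) hle
    have heq : ∀ j : Fin 3, mrun j T = mrun j R₁ := fun j =>
      ((Finset.sum_eq_sum_iff_of_le fun j _ => hge j).1 hsumeq j (mem_univ j)).symm
    exact decoded_term_eq hg hC hGI hTI hFT hnf heq U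
  -- split the pairs into dead and surviving ones
  let f : Site 3 (L' + 1) × Finset (Edge 3 L') → GaugeConfig 3 (L' + 1) G → ℝ := fun p U =>
    esPart η p.2 g (thin L' (torusConfigShift p.1 U))
  let pairs : Finset (Site 3 (L' + 1) × Finset (Edge 3 L')) := univ.filter fun p => fineSupp (L' + 1) p.1 p.2 = F
  let Q : Site 3 (L' + 1) × Finset (Edge 3 L') → Prop := fun p => esPart η p.2 g =ᵐ[configMeasure G L'] 0
  let bad := pairs.filter Q
  let good := pairs.filter fun p => ¬ Q p
  have hgood0 : ((0 : Site 3 (L' + 1)), R₁) ∈ good :=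
    mem_filter.2 ⟨mem_filter.2 ⟨mem_univ _, rfl⟩, hR₁S⟩
  have hN : (0 : ℝ) < (good.card : ℝ) := by exact_mod_cast Finset.card_pos.2 ⟨_, hgood0⟩
  have hsplit : ∀ U, ∑ v : Site 3 (L' + 1), ∑ T ∈ univ.filter (fun T : Finset (Edge 3 L') => fineSupp (L' + 1) v T = F),
        esPart η T g (thin L' (torusConfigShift v U)) = ∑ p ∈ bad, f p U + (good.card : ℝ) * esPart η R₁ g (thin L' U) := by
    intro U
    have h1 : ∑ v : Site 3 (L' + 1), ∑ T ∈ univ.filter (fun T : Finset (Edge 3 L') => fineSupp (L' + 1) v T = F),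
        esPart η T g (thin L' (torusConfigShift v U)) = ∑ p ∈ pairs, f p U := by
      rw [Finset.sum_filter, Fintype.sum_prod_type]
      refine Finset.sum_congr rfl fun v _ => ?_
      rw [Finset.sum_filter]
    rw [h1, ← Finset.sum_filter_add_sum_filter_not pairs Q]
    congr 1
    rw [Finset.sum_congr rfl fun p hp => ?_, Finset.sum_const, nsmul_eq_mul]
    obtain ⟨hp1, hp2⟩ := mem_filter.1 hp
    exact hterm p.1 p.2 (mem_filter.1 hp1).2 hp2 U
  have hbad : (fun U => ∑ p ∈ bad, f p U) =ᵐ[configMeasure G (L' + 1)] 0 := by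
    have hall : ∀ p ∈ bad, ∀ᵐ U ∂configMeasure G (L' + 1), f p U = 0 := by
      intro p hp
      have hQ : esPart η p.2 g =ᵐ[configMeasure G L'] 0 := (mem_filter.1 hp).2
      exact ((pullback_ae_eq_zero_iff (measurable_esPart p.2 hg) (abs_esPart_le p.2 hC) p.1).2 hQ).mono fun U hU => hU
    exact ((Finset.eventually_all bad).2 hall).mono fun U hU => Finset.sum_eq_zero fun p hp => hU p hp
  -- conclude: `N · g^{=R₁} ∘ thin = 0` a.e.
  have hmain : (fun U : GaugeConfig 3 (L' + 1) G => esPart η R₁ g (thin L' (torusConfigShift 0 U))) =ᵐ[configMeasure G (L' + 1)] 0 := by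
    filter_upwards [hstar, hbad] with U hU hU'
    have h0 : torusConfigShift (0 : Site 3 (L' + 1)) U = U := funext fun e => by simp
    have hU1 : ∑ p ∈ bad, f p U + (good.card : ℝ) * esPart η R₁ g (thin L' U) = 0 := by rw [← hsplit U]; exact hU
    have hU2 : ∑ p ∈ bad, f p U = 0 := hU'
    rw [hU2, zero_add] at hU1
    change esPart η R₁ g (thin L' (torusConfigShift 0 U)) = 0
    rw [h0]
    exact (mul_eq_zero.1 hU1).resolve_left hN.ne'
  exact hR₁S ((pullback_ae_eq_zero_iff (measurable_esPart R₁ hg) (abs_esPart_le R₁ hC) 0).1 hmain)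

/-- **W-inj(m = 1), general compact group**: a bounded measurable gauge- and translation-invariant observable whose smeared unit-decimation
pull-back is a.e. constant is itself a.e. constant (equal to its mean). [folklore] -/
theorem ae_eq_const_of_smear_ae_const {g : GaugeConfig 3 L' G → ℝ} (hg : Measurable g) {C : ℝ} (hC : ∀ U, |g U| ≤ C)
    (hGI : ∀ (k : Site 3 L' → G) (W : GaugeConfig 3 L' G), g (gaugeTransform k W) = g W)
    (hTI : ∀ (w : Site 3 L') (U : GaugeConfig 3 L' G), g (torusConfigShift w U) = g U) {c : ℝ}
    (hS : (fun U : GaugeConfig 3 (L' + 1) G => ∑ v : Site 3 (L' + 1), g (thin L' (torusConfigShift v U))) =ᵐ[configMeasure G (L' + 1)]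
      fun _ => c) :
    g =ᵐ[configMeasure G L'] fun _ => ∫ W, g W ∂(configMeasure G L') := by
  classical
  have hparts : ∀ R : Finset (Edge 3 L'), R ≠ ∅ → esPart (haarProbability G) R g =ᵐ[configMeasure G L'] 0 := fun R hR =>
    esPart_ae_eq_zero_of_smear_ae_const hg hC hGI hTI hS R (Finset.nonempty_iff_ne_empty.2 hR)
  have hall : ∀ᵐ W ∂configMeasure G L', ∀ R ∈ (univ : Finset (Finset (Edge 3 L'))).erase ∅, esPart (haarProbability G) R g W = 0 :=
    (Finset.eventually_all _).2 fun R hR => (hparts R (Finset.ne_of_mem_erase hR)).mono fun W hW => hW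
  filter_upwards [hall] with W hW
  rw [← sum_esPart (μ := haarProbability G) g W, ← Finset.add_sum_erase _ _ (mem_univ (∅ : Finset (Edge 3 L'))),
    Finset.sum_eq_zero hW, add_zero, esPart_empty]

end General

end Summit.QuantumFields.YangMills.Theorems.FlatTubeReduction.Decimation
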